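import Summits.PneNP.PneNP.Theorems.NegLimitedHalfWindowTribesCalibration
import Summits.PneNP.PneNP.Theorems.NegLimitedHalfWindowEngineAssembly
import Literature.MathematicalPhysics.QuantumFieldTheory.Z2WilsonLoopGKSUpper
import Mathlib
import HarnessLib

/-!
# Route NegLimited — line `half-window`, stub `stub_tribesNumericsCal` (N): numerics of the tribes calibration
(rung F-N1/p3, ROUND-13; item stmt-PneNP-19888 `NegLimited.NeglimitedHalfLogNegationsR`, registered skeleton
`half-window`; card HOME/pnp-ideate-p3/r13/half-window.md, blueprint r13/BLUEPRINT-R2.md §N)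

`stub_tribesNumericsCal : TribesNumericsCal` — for every `ε > 0` and `0 < p ≤ 1` there is `K₂ > 0` (here `K₂ = 3072`)
with, for all large `w`,

  `tbRHS w (mCal w) (dCal w) p ≤ K₂ · (mCal w · w · 3^{dCal w})^{-(1/2 − ε)}`,

where (tree definitions, `NegLimitedHalfWindowDefs` p488409) `mCal w = ⌊Σ_{j=1}^{w} 2^{w−j}/j⌋`, `dCal w = 10(⌊log₂ w⌋+1)`
and `tbRHS w m d p = |1 − 2(1−c)^m| + 2√((1 − 2c + c²(1+Q)^w)^m − (1−c)^{2m})`, `c = 2^{-w}`, `Q = biasSeq p d`.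

THE PROOF (elementary real analysis, all constants explicit; the calibration and the first-term bound
`|1 − 2(1−2^{-w})^{mCal w}| ≤ 8·2^{-w}` are in `NegLimitedHalfWindowTribesCalibration.lean`):
* VARIANCE (`variance_le`): `(A+B)^m − A^m ≤ m·B` for `0 ≤ A ≤ A + B ≤ 1` (the tree's
  `Literature.MathematicalPhysics.QuantumFieldTheory.pow_sub_pow_le_mul_sub`), `B = c²((1+Q)^w − 1) ≤ 3c²·wQ`
  (`geom_sum_mul`, `(1+Q)^w ≤ e^{wQ} ≤ 3` once `wQ ≤ 1`), and `m c ≤ 1`, so the variance is `≤ 3·2^{-w}`;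
* DECAY (`eventually_w_mul_biasSeq_le_one`): `Q = biasSeq p (dCal w) ≤ C_p (13/16)^{10(⌊log₂ w⌋+1)} ≤ C_p/w²`
  (`biasSeq_decay`, `(13/16)^{10} ≤ 1/4`, `w < 2^{⌊log₂ w⌋+1}`), so `wQ ≤ 1` eventually;
* SIZE (`blocks_le`): `1 ≤ k = mCal w · w · 3^{dCal w} ≤ 2^{16}·2^w·w^{17}` (`3^{10} < 2^{16}`, `2^{⌊log₂ w⌋} ≤ w`;
  `one_le_mCal` from prover-2's `NegLimitedHalfWindowEngineAssembly`, p491190);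
* ASSEMBLY: `tbRHS ≤ 12·2^{-w/2}` and `k^{-(1/2−ε)} ≥ 2^{-8}·2^{-w/2}·2^{εw}·w^{-17(1/2−ε)} ≥ 2^{-8}·2^{-w/2}` once
  `w^9 ≤ 2^{εw}` (`isLittleO_pow_exp_pos_mul_atTop`); for `ε ≥ 1/2` the right-hand side is `≥ K₂ ≥ 12`.

References: R. O'Donnell, *Hardness amplification within NP*, JCSS 69 (2004), §3 [ODonnell2004]; cell record
HOME/pnp-ideate-p3/ROUND-13.md §2 (numerics `tbRHS·√k → 0.70`), r13/BLUEPRINT-R2.md §N.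

HONEST FRAMING: ONE registered (M-sized, bookkeeping) stub of an OPEN rung item; FRONTIER rung F-N1 — nothing here bears on
P vs NP.
-/

set_option linter.dupNamespace false -- `Summit.PneNP.PneNP.…`: summit = sub-problem name (D-0017 single-conjunct layout)

namespace Summit.PneNP.PneNP.Theorems.NegLimitedHalfWindow

open Finset Filter
open Summit.PneNP.PneNP.Theorems.NegLimitedAmplifiedWindow (biasSeq biasSeq_mem biasSeq_decay)

/-! ## The variance term -/

/-- `(1+Q)^w − 1 ≤ 3·w·Q` when `0 ≤ Q` and `w·Q ≤ 1`. -/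
theorem one_add_pow_sub_one_le {Q : ℝ} (hQ : 0 ≤ Q) (w : ℕ) (hwQ : (w : ℝ) * Q ≤ 1) :
    (1 + Q) ^ w - 1 ≤ 3 * (w : ℝ) * Q := by
  have hexp : (1 + Q) ^ w ≤ 3 := by
    have h1 : 1 + Q ≤ Real.exp Q := by have := Real.add_one_le_exp Q; linarith
    calc (1 + Q) ^ w ≤ Real.exp Q ^ w := pow_le_pow_left₀ (by linarith) h1 w
      _ = Real.exp ((w : ℝ) * Q) := (Real.exp_nat_mul Q w).symm
      _ ≤ Real.exp 1 := Real.exp_le_exp.mpr hwQ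
      _ ≤ 3 := by have := Real.exp_one_lt_d9; linarith
  have hgeom : (1 + Q) ^ w - 1 = (∑ i ∈ Finset.range w, (1 + Q) ^ i) * Q := by
    rw [← geom_sum_mul]; ring
  rw [hgeom]
  have hsum : ∑ i ∈ Finset.range w, (1 + Q) ^ i ≤ ∑ _i ∈ Finset.range w, (3 : ℝ) :=
    Finset.sum_le_sum fun i hi => by
      rw [Finset.mem_range] at hi
      exact (pow_le_pow_right₀ (by linarith : (1 : ℝ) ≤ 1 + Q) hi.le).trans hexp
  have hsum' : ∑ _i ∈ Finset.range w, (3 : ℝ) = 3 * (w : ℝ) := by simp [mul_comm]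
  rw [hsum'] at hsum
  nlinarith

/-- **Variance.** `(1 − 2c + c²(1+Q)^w)^m − (1−c)^{2m} ≤ 3c` once `m·c ≤ 1`, `w·Q ≤ 1`, `Q ∈ [0,1]`, `c = 2^{-w}`. -/
theorem variance_le {w m : ℕ} {Q : ℝ} (hQ0 : 0 ≤ Q) (hQ1 : Q ≤ 1) (hwQ : (w : ℝ) * Q ≤ 1)
    (hm : (m : ℝ) * ((1 : ℝ) / 2) ^ w ≤ 1) :
    (1 - 2 * ((1 : ℝ) / 2) ^ w + (((1 : ℝ) / 2) ^ w) ^ 2 * (1 + Q) ^ w) ^ m - (1 - ((1 : ℝ) / 2) ^ w) ^ (2 * m)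
      ≤ 3 * ((1 : ℝ) / 2) ^ w := by
  set c : ℝ := ((1 : ℝ) / 2) ^ w with hc
  have hc0 : 0 < c := by positivity
  have hc1 : c ≤ 1 := pow_le_one₀ (by norm_num) (by norm_num)
  have hone : c * (2 : ℝ) ^ w = 1 := by rw [hc, ← mul_pow]; norm_num
  -- `y = (1-c)² ≤ x = 1 - 2c + c²(1+Q)^w ≤ 1`
  have hQw1 : 1 ≤ (1 + Q) ^ w := one_le_pow₀ (by linarith)
  have hQw2 : (1 + Q) ^ w ≤ (2 : ℝ) ^ w := pow_le_pow_left₀ (by linarith) (by linarith) w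
  have hyx : (1 - c) ^ 2 ≤ 1 - 2 * c + c ^ 2 * (1 + Q) ^ w := by nlinarith
  have hx1 : 1 - 2 * c + c ^ 2 * (1 + Q) ^ w ≤ 1 := by
    have : c ^ 2 * (1 + Q) ^ w ≤ c := by
      calc c ^ 2 * (1 + Q) ^ w ≤ c ^ 2 * (2 : ℝ) ^ w := mul_le_mul_of_nonneg_left hQw2 (sq_nonneg c)
        _ = c * (c * (2 : ℝ) ^ w) := by ring
        _ = c := by rw [hone, mul_one]
    linarith
  rw [pow_mul]
  refine (Literature.MathematicalPhysics.QuantumFieldTheory.pow_sub_pow_le_mul_sub (sq_nonneg (1 - c)) hyx hx1 m).trans ?_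
  have hB : 1 - 2 * c + c ^ 2 * (1 + Q) ^ w - (1 - c) ^ 2 = c ^ 2 * ((1 + Q) ^ w - 1) := by ring
  rw [hB]
  have hgrow := one_add_pow_sub_one_le hQ0 w hwQ
  have hm0 : (0 : ℝ) ≤ m := Nat.cast_nonneg _
  calc (m : ℝ) * (c ^ 2 * ((1 + Q) ^ w - 1)) ≤ (m : ℝ) * (c ^ 2 * (3 * (w : ℝ) * Q)) :=
        mul_le_mul_of_nonneg_left (mul_le_mul_of_nonneg_left hgrow (sq_nonneg c)) hm0
    _ = 3 * c * ((m : ℝ) * c) * ((w : ℝ) * Q) := by ring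
    _ ≤ 3 * c * 1 * 1 := by
        apply mul_le_mul (mul_le_mul_of_nonneg_left hm (by positivity)) hwQ (by positivity) (by positivity)
    _ = 3 * c := by ring

/-! ## Decay of `Q = biasSeq p (dCal w)` and the size of the block count -/

/-- `w · biasSeq p (dCal w) ≤ 1` for all large `w` (`biasSeq_decay` at depth `10(⌊log₂ w⌋+1)`). -/
theorem eventually_w_mul_biasSeq_le_one {p : ℝ} (hp : 0 < p) (hp1 : p ≤ 1) :
    ∀ᶠ w : ℕ in atTop, (w : ℝ) * biasSeq p (dCal w) ≤ 1 := by
  obtain ⟨C, hC, hCd⟩ := biasSeq_decay hp hp1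
  filter_upwards [eventually_ge_atTop (max 1 ⌈C⌉₊)] with w hw
  have hw1 : 1 ≤ w := le_of_max_le_left hw
  have hwC : C ≤ (w : ℝ) := (Nat.le_ceil C).trans (by exact_mod_cast le_of_max_le_right hw)
  have hw0 : (0 : ℝ) < w := by exact_mod_cast hw1
  -- `(13/16)^(10(L+1)) ≤ (1/4)^(L+1) ≤ 1/w²`
  set L := Nat.log 2 w with hL
  have hlt : (w : ℝ) < (2 : ℝ) ^ (L + 1) := by exact_mod_cast Nat.lt_pow_succ_log_self one_lt_two w
  have hQ : biasSeq p (dCal w) ≤ C * ((1 : ℝ) / w) ^ 2 := by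
    refine (hCd (dCal w)).trans (mul_le_mul_of_nonneg_left ?_ hC.le)
    unfold dCal
    rw [pow_mul]
    have h12 : ((1 : ℝ) / 2) ^ (L + 1) ≤ 1 / (w : ℝ) := by
      rw [one_div_pow]
      exact one_div_le_one_div_of_le hw0 hlt.le
    calc ((13 / 16 : ℝ) ^ 10) ^ (Nat.log 2 w + 1) ≤ (((1 : ℝ) / 2) ^ 2) ^ (Nat.log 2 w + 1) :=
          pow_le_pow_left₀ (by norm_num) (by norm_num) _
      _ = (((1 : ℝ) / 2) ^ (L + 1)) ^ 2 := by rw [hL, ← pow_mul, ← pow_mul, mul_comm]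
      _ ≤ ((1 : ℝ) / w) ^ 2 := pow_le_pow_left₀ (by positivity) h12 2
  calc (w : ℝ) * biasSeq p (dCal w) ≤ (w : ℝ) * (C * ((1 : ℝ) / w) ^ 2) :=
        mul_le_mul_of_nonneg_left hQ hw0.le
    _ = C / w := by field_simp
    _ ≤ 1 := by rw [div_le_one hw0]; exact hwC

/-- `3^{dCal w} ≤ 2^{16}·w^{16}` for `w ≥ 1` (`3^{10} < 2^{16}` and `2^{⌊log₂ w⌋} ≤ w`). -/
theorem three_pow_dCal_le {w : ℕ} (hw : 1 ≤ w) : 3 ^ dCal w ≤ 2 ^ 16 * w ^ 16 := by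
  unfold dCal
  have hlog : 2 ^ Nat.log 2 w ≤ w := Nat.pow_log_le_self 2 (by omega)
  calc 3 ^ (10 * (Nat.log 2 w + 1)) = (3 ^ 10) ^ (Nat.log 2 w + 1) := pow_mul _ _ _
    _ ≤ (2 ^ 16) ^ (Nat.log 2 w + 1) := Nat.pow_le_pow_left (by norm_num) _
    _ = 2 ^ 16 * (2 ^ Nat.log 2 w) ^ 16 := by rw [pow_succ, ← pow_mul, ← pow_mul, mul_comm 16 (Nat.log 2 w)]; ring
    _ ≤ 2 ^ 16 * w ^ 16 := Nat.mul_le_mul_left _ (Nat.pow_le_pow_left hlog _)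

/-- **Size of the block count**: `mCal w · w · 3^{dCal w} ≤ 2^{16}·2^w·w^{17}` for `w ≥ 2`. -/
theorem blocks_le {w : ℕ} (hw : 2 ≤ w) :
    (((mCal w * w * 3 ^ dCal w : ℕ)) : ℝ) ≤ (2 : ℝ) ^ (16 : ℕ) * (2 : ℝ) ^ w * (w : ℝ) ^ (17 : ℕ) := by
  have hm : (mCal w : ℝ) ≤ (2 : ℝ) ^ w := by
    have h := mCal_mul_le_one hw
    have hone : ((1 : ℝ) / 2) ^ w * (2 : ℝ) ^ w = 1 := by rw [← mul_pow]; norm_num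
    have := mul_le_mul_of_nonneg_right h (by positivity : (0 : ℝ) ≤ (2 : ℝ) ^ w)
    rwa [mul_assoc, hone, mul_one, one_mul] at this
  have h3 : ((3 ^ dCal w : ℕ) : ℝ) ≤ (2 : ℝ) ^ (16 : ℕ) * (w : ℝ) ^ (16 : ℕ) := by
    exact_mod_cast three_pow_dCal_le (by omega : 1 ≤ w)
  push_cast
  have hw0 : (0 : ℝ) ≤ w := Nat.cast_nonneg _
  calc (mCal w : ℝ) * (w : ℝ) * (3 : ℝ) ^ dCal w ≤ (2 : ℝ) ^ w * (w : ℝ) * ((2 : ℝ) ^ (16 : ℕ) * (w : ℝ) ^ (16 : ℕ)) := by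
        apply mul_le_mul (mul_le_mul_of_nonneg_right hm hw0) (by exact_mod_cast three_pow_dCal_le (by omega : 1 ≤ w))
          (by positivity) (by positivity)
    _ = (2 : ℝ) ^ (16 : ℕ) * (2 : ℝ) ^ w * (w : ℝ) ^ (17 : ℕ) := by ring

/-- Polynomials lose against exponentials: `w^9 ≤ 2^{εw}` for all large `w`. -/
theorem eventually_pow_nine_le_two_rpow {ε : ℝ} (hε : 0 < ε) :
    ∀ᶠ w : ℕ in atTop, (w : ℝ) ^ (9 : ℕ) ≤ (2 : ℝ) ^ (ε * (w : ℝ)) := by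
  have hb : 0 < ε * Real.log 2 := mul_pos hε (Real.log_pos one_lt_two)
  have h := (isLittleO_pow_exp_pos_mul_atTop 9 hb).def zero_lt_one
  have h' := tendsto_natCast_atTop_atTop.eventually h
  filter_upwards [h'] with w hw
  rw [one_mul, Real.norm_of_nonneg (by positivity), Real.norm_of_nonneg (Real.exp_pos _).le] at hw
  rw [Real.rpow_def_of_pos two_pos]
  convert hw using 2
  ring

/-! ## The stub -/

/-- `tbRHS w (mCal w) (dCal w) p ≤ 12·√(2^{-w})` once `w ≥ 2` and `w·Q ≤ 1`. -/
theorem tbRHS_le_twelve_sqrt {p : ℝ} (hp : 0 < p) (hp1 : p ≤ 1) {w : ℕ} (hw : 2 ≤ w)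
    (hwQ : (w : ℝ) * biasSeq p (dCal w) ≤ 1) :
    tbRHS w (mCal w) (dCal w) p ≤ 12 * Real.sqrt (((1 : ℝ) / 2) ^ w) := by
  unfold tbRHS
  set c : ℝ := ((1 : ℝ) / 2) ^ w with hc
  have hc0 : 0 ≤ c := by positivity
  have hc1 : c ≤ 1 := pow_le_one₀ (by norm_num) (by norm_num)
  obtain ⟨hQ0, hQ1⟩ := biasSeq_mem hp.le hp1 (dCal w)
  have hF := first_term_le hw
  have hV := variance_le (m := mCal w) hQ0 hQ1 hwQ (mCal_mul_le_one hw)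
  rw [← hc] at hF hV
  have hsqV : Real.sqrt ((1 - 2 * c + c ^ 2 * (1 + biasSeq p (dCal w)) ^ w) ^ mCal w - (1 - c) ^ (2 * mCal w))
      ≤ 2 * Real.sqrt c := by
    refine (Real.sqrt_le_sqrt hV).trans ?_
    have h4 : Real.sqrt (3 * c) ≤ Real.sqrt (2 ^ 2 * c) := Real.sqrt_le_sqrt (by nlinarith)
    have h4' : Real.sqrt (2 ^ 2 * c) = 2 * Real.sqrt c := by
      rw [Real.sqrt_mul (by norm_num) c, Real.sqrt_sq (by norm_num)]
    exact h4.trans h4'.le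
  have hcs : c ≤ Real.sqrt c := by
    rw [Real.le_sqrt hc0 hc0]; nlinarith
  linarith

/-- **Registered stub `stub_tribesNumericsCal`** of the skeleton `half-window` (stmt-PneNP-19888): along the calibration
`m = mCal w`, `d = dCal w` the tribes bias response is `≤ 3072·(m·w·3^d)^{-(1/2−ε)}` for all large `w`, BY NAME. -/
theorem stub_tribesNumericsCal : TribesNumericsCal := by
  intro ε hε p hp hp1
  refine ⟨3072, by norm_num, ?_⟩
  filter_upwards [eventually_ge_atTop 2, eventually_w_mul_biasSeq_le_one hp hp1,
    eventually_pow_nine_le_two_rpow hε] with w hw hwQ hpoly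
  have htb := tbRHS_le_twelve_sqrt hp hp1 hw hwQ
  set a : ℝ := 1 / 2 - ε with ha
  set k : ℝ := ((mCal w * w * 3 ^ dCal w : ℕ) : ℝ) with hk
  have hw1 : (1 : ℝ) ≤ w := by exact_mod_cast (by omega : 1 ≤ w)
  have hk1 : (1 : ℝ) ≤ k := by
    rw [hk]
    have h1 : 1 ≤ mCal w * w * 3 ^ dCal w :=
      Nat.mul_pos (Nat.mul_pos (one_le_mCal (by omega)) (by omega)) (Nat.one_le_pow _ _ (by norm_num))
    exact_mod_cast h1
  have hk0 : 0 < k := by linarith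
  have hsqrt_le_one : Real.sqrt (((1 : ℝ) / 2) ^ w) ≤ 1 :=
    Real.sqrt_le_one.mpr (pow_le_one₀ (by norm_num) (by norm_num))
  by_cases hε2 : ε < 1 / 2
  · -- main case: `0 < a ≤ 1/2`
    have ha0 : 0 < a := by linarith
    have ha1 : a ≤ 1 / 2 := by linarith
    -- `√c = 2^{-w/2}`
    have hsqrt : Real.sqrt (((1 : ℝ) / 2) ^ w) = (2 : ℝ) ^ (-((w : ℝ) / 2)) := by
      have h1 : ((1 : ℝ) / 2) ^ w = (2 : ℝ) ^ (-(w : ℝ)) := by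
        rw [Real.rpow_neg (by norm_num), Real.rpow_natCast, one_div_pow, one_div]
      rw [h1, Real.sqrt_eq_rpow, ← Real.rpow_mul (by norm_num)]
      congr 1
      ring
    -- `k ≤ U = 2^16 · 2^w · w^17` in `rpow` form
    have hU : k ≤ (2 : ℝ) ^ (16 : ℝ) * (2 : ℝ) ^ (w : ℝ) * (w : ℝ) ^ (17 : ℝ) := by
      have h := blocks_le hw
      rw [← hk] at h
      have e1 : (2 : ℝ) ^ (16 : ℝ) = (2 : ℝ) ^ (16 : ℕ) := by exact_mod_cast Real.rpow_natCast 2 16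
      have e2 : (2 : ℝ) ^ (w : ℝ) = (2 : ℝ) ^ w := Real.rpow_natCast 2 w
      have e3 : (w : ℝ) ^ (17 : ℝ) = (w : ℝ) ^ (17 : ℕ) := by exact_mod_cast Real.rpow_natCast (w : ℝ) 17
      rw [e1, e2, e3]
      exact h
    have hUpos : 0 < (2 : ℝ) ^ (16 : ℝ) * (2 : ℝ) ^ (w : ℝ) * (w : ℝ) ^ (17 : ℝ) := by positivity
    -- lower bound for `k^{-a}`
    have step1 : ((2 : ℝ) ^ (16 : ℝ) * (2 : ℝ) ^ (w : ℝ) * (w : ℝ) ^ (17 : ℝ)) ^ (-a) ≤ k ^ (-a) :=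
      Real.rpow_le_rpow_of_nonpos hk0 hU (by linarith)
    have step2 : ((2 : ℝ) ^ (16 : ℝ) * (2 : ℝ) ^ (w : ℝ) * (w : ℝ) ^ (17 : ℝ)) ^ (-a) =
        (2 : ℝ) ^ ((16 : ℝ) * -a) * (2 : ℝ) ^ ((w : ℝ) * -a) * (w : ℝ) ^ ((17 : ℝ) * -a) := by
      rw [Real.mul_rpow (by positivity) (by positivity), Real.mul_rpow (by positivity) (by positivity),
        ← Real.rpow_mul (by norm_num), ← Real.rpow_mul (by norm_num), ← Real.rpow_mul (by positivity)]
    have step3 : (2 : ℝ) ^ (-(8 : ℝ)) ≤ (2 : ℝ) ^ ((16 : ℝ) * -a) :=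
      Real.rpow_le_rpow_of_exponent_le one_le_two (by nlinarith)
    have step4 : (2 : ℝ) ^ (-(ε * (w : ℝ))) ≤ (w : ℝ) ^ ((17 : ℝ) * -a) := by
      have h1 : (w : ℝ) ^ (-(9 : ℝ)) ≤ (w : ℝ) ^ ((17 : ℝ) * -a) :=
        Real.rpow_le_rpow_of_exponent_le hw1 (by nlinarith)
      have h2 : (2 : ℝ) ^ (-(ε * (w : ℝ))) ≤ (w : ℝ) ^ (-(9 : ℝ)) := by
        rw [Real.rpow_neg (by norm_num), Real.rpow_neg (by positivity)]
        have h9 : (w : ℝ) ^ (9 : ℝ) = (w : ℝ) ^ (9 : ℕ) := by exact_mod_cast Real.rpow_natCast (w : ℝ) 9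
        rw [h9]
        exact inv_anti₀ (by positivity) hpoly
      exact h2.trans h1
    have h256 : (2 : ℝ) ^ (-(8 : ℝ)) = 1 / 256 := by
      rw [Real.rpow_neg (by norm_num), show (8 : ℝ) = ((8 : ℕ) : ℝ) by norm_num, Real.rpow_natCast]
      norm_num
    have hcomb : (2 : ℝ) ^ ((w : ℝ) * -a) * (2 : ℝ) ^ (-(ε * (w : ℝ))) = (2 : ℝ) ^ (-((w : ℝ) / 2)) := by
      rw [← Real.rpow_add two_pos]
      congr 1
      rw [ha]
      ring
    calc tbRHS w (mCal w) (dCal w) p ≤ 12 * Real.sqrt (((1 : ℝ) / 2) ^ w) := htb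
      _ = 3072 * ((2 : ℝ) ^ (-(8 : ℝ)) * ((2 : ℝ) ^ ((w : ℝ) * -a) * (2 : ℝ) ^ (-(ε * (w : ℝ))))) := by
          rw [hcomb, hsqrt, h256]; ring
      _ ≤ 3072 * ((2 : ℝ) ^ ((16 : ℝ) * -a) * ((2 : ℝ) ^ ((w : ℝ) * -a) * (w : ℝ) ^ ((17 : ℝ) * -a))) := by
          apply mul_le_mul_of_nonneg_left _ (by norm_num)
          apply mul_le_mul step3 (mul_le_mul_of_nonneg_left step4 (by positivity)) (by positivity) (by positivity)
      _ = 3072 * ((2 : ℝ) ^ (16 : ℝ) * (2 : ℝ) ^ (w : ℝ) * (w : ℝ) ^ (17 : ℝ)) ^ (-a) := by rw [step2]; ring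
      _ ≤ 3072 * k ^ (-a) := mul_le_mul_of_nonneg_left step1 (by norm_num)
  · -- trivial case: `a ≤ 0`, so `k^{-a} ≥ 1`
    have ha0 : 0 ≤ -a := by linarith
    have hk2 : (1 : ℝ) ≤ k ^ (-a) := Real.one_le_rpow hk1 ha0
    calc tbRHS w (mCal w) (dCal w) p ≤ 12 * Real.sqrt (((1 : ℝ) / 2) ^ w) := htb
      _ ≤ 12 * 1 := by linarith
      _ ≤ 3072 * k ^ (-a) := by linarith

end Summit.PneNP.PneNP.Theorems.NegLimitedHalfWindow
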